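import Literature.MathematicalPhysics.QuantumFieldTheory.Balaban1983to89.T4TwoRunUniqueness
import Literature.MathematicalPhysics.QuantumFieldTheory.Balaban1983to89.T4ContinuumCoupling
import Literature.MathematicalPhysics.QuantumFieldTheory.Balaban1983to89.T4BetaReadOutLipschitz

/-!
# Spine/NE4/Targets — spine row NE4 (node U2: the η-rate of the FULL β-functions) STATED ON THE DATA, with node U2's
# input triple, its output along the data's tuned runs, and the landed faces upstream / downstream BY NAME

Cell `pub-balaban-gaps` (YM blitz G2), seat `ne4` (unit `pub-balaban-gaps-ne4-g0`), record `HOME/ne/NE4.md`.  Sibling of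
`Spine/NE2/Targets`, `Spine/NE5/LeafIndex`, `Spine/NE9/LeafIndex`: row NE4 had no `Spine/` entry (owner lineage `t4-ne4-p1/p2/p3`
PARKED by the YM redirect, BINDER-OWNERS rows NE4 / NE4·P3).

WHAT THIS FILE IS.  Vocabulary + kernel re-checks, NOTHING ELSE.  (i) `NE4OnData D c θ γ` [shape] := the tree's hypothesis shape
`T4CouplingMatching.ScaleShiftRate c θ γ` AT THE DATA'S OWN β-FAMILY `D.βfun : FlowStep.HBeta` (`T4Continuum.FiniteEpsData`; the
history-dependent β_{k+1}(g_0,…,g_k) of [Balaban1987RG1] (0.20) p. 256 / p. 298 that generate the data's coupling flows, field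
`D.fwd`); `U2Inputs D c C θ γ Λ` [shape] := node U2's full input triple `ScaleShiftRate ∧ HistLipschitz Λ ∧ FadingMemory C θ Λ` on
`D.βfun`; `runFlow D g₀ K` := the coupling flow of the data's `K`-step run at bare coupling `g₀ K`; `U2Output D g₀ Cout θ` [shape] :=
node U2's OUTPUT in the spine's currency, `T4CauchySum.InjectedRate Cout 0 θ` of the two-run discrepancies
`disc (runFlow D g₀ K) (runFlow D g₀ (K+1))` of CONSECUTIVE runs of the data along a bare-coupling sequence `g₀`.  (ii) The faces,
each ONE application of a landed tree theorem BY NAME with `β := D.βfun`, `g := runFlow D g₀`: `u2Output_of_u2Inputs`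
(`T4CouplingMatching.injectedRate_of_runs_eventual` joined to the data by `T4TwoRunUniqueness.rgEqH_of_tuned` and the definition of
`FiniteEpsData.Tuned` — the joiner that `T4CouplingMatching` §5's docstring names and leaves to "neither module is imported here"),
`u2Output_under` (the same under the targets' quantifier prefix `FiniteEpsData.UnderHypotheses`), `continuumRunning_of_u2Output`
(`T4ContinuumCoupling.continuumRunning_of_injectedRate`: the continuum running coupling of the data's tuned runs),
`tunedUniqueBelow_of_u2Inputs` (`T4TwoRunUniqueness.tunedUniqueBelow_of_eventualLower`: [Balaban1987RG1] Thm 2's `g₀(ε, g)` is a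
FUNCTION under node U2's binders) and `u2Inputs_of_u3` (`T4BetaReadOutLipschitz.ne4_of_u3_on`: the triple ⇐ rows NE5 ∧ NE9 ∧ the
read-out (R), on abstract carriers whose read-out REPRESENTS `D.βfun`).

WHAT THIS FILE IS NOT.  Not an estimate and not an instance: `NE4OnData D …` / `U2Inputs D …` are BINDERS in every theorem; nothing of
Bałaban's is asserted; no `def … : Prop` fact is minted; rows NE5 / NE9 / (R) enter `u2Inputs_of_u3` as binders exactly as in the
tree.  HONEST FRAMING: NE4 is NOT IN PRINT ([Balaban1987RG1] p. 264 «We will investigate other properties in a separate paper»;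
p. 298 names the history dependence only; cell GAPS G-t4-U2-1, G-t4-U2-2) and NOT PROVED; it is booked DEPENDENT = (R)∘{NE5, NE9} (T4-DAG §6);
spine PROVED 0/9 unchanged.  Rung (B)+1 bookkeeping on ONE finite T⁴ — NOT infinite volume, NOT a mass gap, NOT Clay.  HONEST
DEPENDENCY: continuum YM on T⁴ ⇐ BetaPertH ∧ nine spine estimates (0/9 proved); BetaPertH ⇐ (D1) ∧ (D4) ∧ CAP+tail.  0 sorry; axioms
standard; imports three Literature modules, modifies nothing.

References (locators only; nothing printed is a hypothesis-free input): [Balaban1987RG1] = CMP 109 (1987), (0.20) p. 256, Thm 2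
p. 259, (1.20)–(1.22) and Thm 3 p. 264, p. 298.
-/

noncomputable section

namespace Summit.QuantumFields.BalabanUV.T4Continuum.Spine.NE4

open Literature.MathematicalPhysics.QuantumFieldTheory.Balaban1983to89
open Literature.MathematicalPhysics.QuantumFieldTheory.Balaban1983to89.FlowStep
open Literature.MathematicalPhysics.QuantumFieldTheory.Balaban1983to89.T4CouplingMatching
open Literature.MathematicalPhysics.QuantumFieldTheory.Balaban1983to89.T4Continuum
open Literature.MathematicalPhysics.QuantumFieldTheory.Balaban1983to89.T4TwoRunUniqueness
  (TunedUniqueBelow rgEqH_of_tuned tunedUniqueBelow_of_eventualLower)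
open Literature.MathematicalPhysics.QuantumFieldTheory.Balaban1983to89.T4ContinuumCoupling
  (ContinuumRunning continuumRunning_of_injectedRate)
open Literature.MathematicalPhysics.QuantumFieldTheory.Balaban1983to89.T4OutputRate (Carriers Functional NE5 NE9)
open Literature.MathematicalPhysics.QuantumFieldTheory.Balaban1983to89.T4BetaReadOut
  (Slice ReadOut RepresentsA RepresentsB)
open Literature.MathematicalPhysics.QuantumFieldTheory.Balaban1983to89.T4BetaReadOutLipschitz
  (ReadBoundedOn ReadCovariantOn ne4_of_u3_on)
open Literature.MathematicalPhysics.QuantumFieldTheory.Balaban1983to89.T4FlagMemory (extd)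

universe u

variable {F : T4Family} {G : Type u} [GaugeGroup G] [MeasurableSpace G] [HaarData G]

/-! ## §1 The named shapes ON THE DATA -/

/-- [shape] **NE4 ON THE DATA** — the η-rate of the FULL β-functions of Bałaban's data `D`: the tree's hypothesis shape
`T4CouplingMatching.ScaleShiftRate c θ γ` at `β := D.βfun`, i.e. `|β_{k+2}(g_0,…,g_{k+1}) − β_{k+1}(g_1,…,g_{k+1})| ≤ c·θ^k` on the boxes
`]0,γ]^{k+2}`.  A parametric definition of a proposition — NOT a fact; NOT IN PRINT for (1.22). [folklore] -/
def NE4OnData (D : FiniteEpsData F G) (c θ γ : ℝ) : Prop := ScaleShiftRate c θ γ D.βfun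

/-- [shape] **NODE U2's INPUT TRIPLE ON THE DATA**: NE4 proper, the history moduli `Λ` of `D.βfun` on the γ-boxes, and their
fading memory `Λ k i ≤ C·θ^{k−i}` (one rate `θ` shared, rates can always be worsened).  NOT a fact. [folklore] -/
def U2Inputs (D : FiniteEpsData F G) (c C θ γ : ℝ) (Λ : ℕ → ℕ → ℝ) : Prop :=
  ScaleShiftRate c θ γ D.βfun ∧ HistLipschitz Λ γ D.βfun ∧ FadingMemory C θ Λ

/-- The coupling flow `k ↦ g_k` of the data's `K`-step run (spacing `ε = L^{−K}`) started at the bare coupling `g₀ K` of a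
bare-coupling sequence `g₀` ([Balaban1987RG1] (0.20); the run `⟨K, F.m, g₀ K⟩` of the construction `D.C`). [folklore] -/
def runFlow (D : FiniteEpsData F G) (g₀ : ℕ → ℝ) (K : ℕ) : ℕ → ℝ := (D.C ⟨K, F.m, g₀ K⟩).flow.g

/-- [shape] **NODE U2's OUTPUT ON THE DATA** along the bare-coupling sequence `g₀`: the discrepancies
`disc (g^{(K)}) (g^{(K+1)}) j = |1/(g^{(K)}_j)² − 1/(g^{(K+1)}_{j+1})²|` of CONSECUTIVE runs obey `T4CauchySum.InjectedRate Cout 0 θ`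
(`≤ Cout·θ^j`, uniformly in `K`) — node U6's input from node U2.  NOT a fact. [folklore] -/
def U2Output (D : FiniteEpsData F G) (g₀ : ℕ → ℝ) (Cout θ : ℝ) : Prop :=
  T4CauchySum.InjectedRate Cout 0 θ fun K j => disc (runFlow D g₀ K) (runFlow D g₀ (K + 1)) j

/-! ## §2 Bookkeeping on the shapes -/

/-- [bookkeeping] `NE4OnData D` is `ScaleShiftRate … D.βfun`, definitionally. [folklore] -/
theorem ne4OnData_iff (D : FiniteEpsData F G) (c θ γ : ℝ) : NE4OnData D c θ γ ↔ ScaleShiftRate c θ γ D.βfun := Iff.rfl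

/-- [bookkeeping] the first component of the triple is NE4 proper. [folklore] -/
theorem U2Inputs.ne4 {D : FiniteEpsData F G} {c C θ γ : ℝ} {Λ : ℕ → ℕ → ℝ} (h : U2Inputs D c C θ γ Λ) : NE4OnData D c θ γ :=
  h.1

/-- [bookkeeping] the bare coupling of the `K`-step run IS `g₀ K` (`FiniteEpsData.flow_zero`). [folklore] -/
theorem runFlow_zero (D : FiniteEpsData F G) (g₀ : ℕ → ℝ) (K : ℕ) : runFlow D g₀ K 0 = g₀ K :=
  D.flow_zero K (g₀ K)

/-- [bookkeeping] a TUNED sequence ([Balaban1987RG1] Thm 2 p. 259: every run in `]0,γ]`, `g_K = g`) gives the box and the pin of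
`T4CouplingMatching` §5 for `runFlow`. [folklore] -/
theorem box_and_pin_of_tuned (D : FiniteEpsData F G) {γ g : ℝ} {g₀ : ℕ → ℝ} (ht : D.Tuned γ g g₀) :
    (∀ K i, i ≤ K → 0 < runFlow D g₀ K i ∧ runFlow D g₀ K i ≤ γ) ∧ ∀ K, runFlow D g₀ K K = g :=
  ⟨fun K i hi => (ht K).1 i hi, fun K => (ht K).2⟩

/-- [bookkeeping] the triple restricts from the `γᵤ`-boxes to the `γ`-boxes, `γ ≤ γᵤ` (`FlowStep.box_mono`). [folklore] -/
theorem U2Inputs.mono {D : FiniteEpsData F G} {c C θ γ γu : ℝ} {Λ : ℕ → ℕ → ℝ} (h : U2Inputs D c C θ γu Λ)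
    (hγle : γ ≤ γu) : U2Inputs D c C θ γ Λ :=
  ⟨fun k w hw => h.1 k w (box_mono hγle (k + 1) hw),
    fun k p q hp hq => h.2.1 k p q (box_mono hγle k hp) (box_mono hγle k hq), h.2.2⟩

/-! ## §3 Downstream faces: node U2's output on the data, the continuum running coupling, tuned uniqueness -/

/-- [bookkeeping] **NODE U2's OUTPUT ON THE DATA ⇐ ITS INPUT TRIPLE** (run-wise, one `γ`): the triple on the γ-boxes, the
eventual lower bound `EventualLowerH b γ k₀ D.βfun` (`b > 0`), the printed-type upper bound `BetaUpperH β′ γ D.βfun` with `γ²β′ < 1`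
(only to run (0.20) forward, `rgEqH_of_tuned`), a sequence `g₀` TUNED to `g` within `]0,γ]`, and the window
`C·((k₀+1)γ³ + 2γ/b) ≤ (1−θ)/2` give `U2Output D g₀ (2c/(1−θ)) θ` — `T4CouplingMatching.injectedRate_of_runs_eventual` applied to
`g := runFlow D g₀`, `gIR := g`.  Every β-side binder UNPRINTED. [folklore] -/
theorem u2Output_of_u2Inputs (D : FiniteEpsData F G) {c C θ γ b β' g : ℝ} {k₀ : ℕ} {Λ : ℕ → ℕ → ℝ} {g₀ : ℕ → ℝ}
    (hI : U2Inputs D c C θ γ Λ) (hγ : 0 < γ) (hb : 0 < b) (hθ0 : 0 < θ) (hθ1 : θ < 1) (hc : 0 ≤ c) (hC : 0 ≤ C)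
    (hlo : EventualLowerH b γ k₀ D.βfun) (hhi : BetaUpperH β' γ D.βfun) (hγβ : γ ^ 2 * β' < 1) (ht : D.Tuned γ g g₀)
    (hsmall : C * (((k₀ : ℝ) + 1) * γ ^ 3 + 2 * γ / b) ≤ (1 - θ) / 2) :
    U2Output D g₀ (2 * c / (1 - θ)) θ := by
  obtain ⟨hbox, hpin⟩ := box_and_pin_of_tuned D ht
  exact injectedRate_of_runs_eventual (runFlow D g₀) g hγ hb hθ0 hθ1 hc hC
    (fun K => rgEqH_of_tuned D hhi hγβ hγ le_rfl ht K) hbox hpin hI.1 hI.2.1 hI.2.2 hlo hsmall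

/-- [bookkeeping] **THE SAME UNDER THE TARGETS' QUANTIFIER PREFIX** (`FiniteEpsData.UnderHypotheses Hβ`): with the triple, the
eventual lower bound and the printed-type upper bound given on ONE box `]0,γᵤ]` and the window there, node U2's output holds for
EVERY `γ ≤ γᵤ`, every `g` and every sequence tuned to `g` within `]0,γ]` (threshold `γ₀ := γᵤ`; the `g`-threshold is idle, `g₁ := 1`),
whatever `Hβ` and (B) are — they are not used.  Monotonicity of the window in `γ` and `box_mono`. [folklore] -/
theorem u2Output_under (D : FiniteEpsData F G) {Hβ : Prop} {c C θ γu b β' : ℝ} {k₀ : ℕ} {Λ : ℕ → ℕ → ℝ}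
    (hI : U2Inputs D c C θ γu Λ) (hγu : 0 < γu) (hb : 0 < b) (hθ0 : 0 < θ) (hθ1 : θ < 1) (hc : 0 ≤ c) (hC : 0 ≤ C)
    (hlo : EventualLowerH b γu k₀ D.βfun) (hhi : BetaUpperH β' γu D.βfun) (hγβ : γu ^ 2 * β' < 1)
    (hsmall : C * (((k₀ : ℝ) + 1) * γu ^ 3 + 2 * γu / b) ≤ (1 - θ) / 2) :
    D.UnderHypotheses Hβ fun g₀ => U2Output D g₀ (2 * c / (1 - θ)) θ := by
  intro _ _
  refine ⟨γu, hγu, fun γ hγ hγle => ⟨1, one_pos, fun g _ _ g₀ ht => ?_⟩⟩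
  have hlo' : EventualLowerH b γ k₀ D.βfun := fun k v hk hv => hlo k v hk (box_mono hγle k hv)
  have hhi' : BetaUpperH β' γ D.βfun := fun k v hv => hhi k v (box_mono hγle k hv)
  have hγβ' : γ ^ 2 * β' < 1 := by
    rcases le_or_gt β' 0 with hβ | hβ
    · exact lt_of_le_of_lt (mul_nonpos_of_nonneg_of_nonpos (sq_nonneg γ) hβ) one_pos
    · exact lt_of_le_of_lt (mul_le_mul_of_nonneg_right (pow_le_pow_left₀ hγ.le hγle 2) hβ.le) hγβ
  have hmono : ((k₀ : ℝ) + 1) * γ ^ 3 + 2 * γ / b ≤ ((k₀ : ℝ) + 1) * γu ^ 3 + 2 * γu / b :=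
    add_le_add (mul_le_mul_of_nonneg_left (pow_le_pow_left₀ hγ.le hγle 3) (by positivity))
      (div_le_div_of_nonneg_right (mul_le_mul_of_nonneg_left hγle zero_le_two) hb.le)
  have hsmall' : C * (((k₀ : ℝ) + 1) * γ ^ 3 + 2 * γ / b) ≤ (1 - θ) / 2 :=
    (mul_le_mul_of_nonneg_left hmono hC).trans hsmall
  exact u2Output_of_u2Inputs D (hI.mono hγle) hγ hb hθ0 hθ1 hc hC hlo' hhi' hγβ' ht hsmall'

/-- [bookkeeping] **NODE U2's OUTPUT ⇒ THE CONTINUUM RUNNING COUPLING OF THE DATA's TUNED RUNS**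
(`T4ContinuumCoupling.continuumRunning_of_injectedRate`, BY NAME): `U2Output D g₀ Cout θ` with `θ < 1`, a sequence tuned to `g`
within `]0,γ]`, (0.20) run forward (`BetaUpperH`, `γ²β′ < 1`) and `EventualLowerH b γ k₀ D.βfun` with `b ≥ 0` give
`ContinuumRunning D.βfun (runFlow D g₀) g γ b`: the couplings `g^{(n+m)}_n` converge at every physical scale `m` to `g*_m ∈ ]0,γ]`,
`g*_0 = g`, limit flow `1/g*²_{m+1} = 1/g*²_m + b*_m`, `b*_m ≥ b`, geometric tail.  Structural consequence, NOT an estimate. [folklore] -/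
theorem continuumRunning_of_u2Output (D : FiniteEpsData F G) {Cout θ γ b β' g : ℝ} {k₀ : ℕ} {g₀ : ℕ → ℝ}
    (hO : U2Output D g₀ Cout θ) (hθ1 : θ < 1) (hγ : 0 < γ) (hhi : BetaUpperH β' γ D.βfun) (hγβ : γ ^ 2 * β' < 1)
    (ht : D.Tuned γ g g₀) (hlo : EventualLowerH b γ k₀ D.βfun) (hb : 0 ≤ b) :
    ContinuumRunning D.βfun (runFlow D g₀) g γ b := by
  obtain ⟨hbox, hpin⟩ := box_and_pin_of_tuned D ht
  exact continuumRunning_of_injectedRate hθ1 hO (fun K => rgEqH_of_tuned D hhi hγβ hγ le_rfl ht K) hbox hpin hlo hb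

/-- [bookkeeping] **END TO END ON THE DATA**: the input triple + the β-side binders + a tuned sequence + the window give the
continuum running coupling (`u2Output_of_u2Inputs` then `continuumRunning_of_u2Output`). [folklore] -/
theorem continuumRunning_of_u2Inputs (D : FiniteEpsData F G) {c C θ γ b β' g : ℝ} {k₀ : ℕ} {Λ : ℕ → ℕ → ℝ}
    {g₀ : ℕ → ℝ} (hI : U2Inputs D c C θ γ Λ) (hγ : 0 < γ) (hb : 0 < b) (hθ0 : 0 < θ) (hθ1 : θ < 1) (hc : 0 ≤ c)
    (hC : 0 ≤ C) (hlo : EventualLowerH b γ k₀ D.βfun) (hhi : BetaUpperH β' γ D.βfun) (hγβ : γ ^ 2 * β' < 1)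
    (ht : D.Tuned γ g g₀) (hsmall : C * (((k₀ : ℝ) + 1) * γ ^ 3 + 2 * γ / b) ≤ (1 - θ) / 2) :
    ContinuumRunning D.βfun (runFlow D g₀) g γ b :=
  continuumRunning_of_u2Output D (u2Output_of_u2Inputs D hI hγ hb hθ0 hθ1 hc hC hlo hhi hγβ ht hsmall) hθ1 hγ hhi hγβ
    ht hlo hb.le

/-- [bookkeeping] **TUNED UNIQUENESS FROM NODE U2's BINDERS** (`T4TwoRunUniqueness.tunedUniqueBelow_of_eventualLower`, BY NAME):
the history/memory half of the triple on the `γᵤ`-boxes, `EventualLowerH`, the printed-type `BetaUpperH` with `γᵤ²β′ < 1` and the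
window `C·((k₀+1)γᵤ³ + 2γᵤ/b) < 1 − θ` make [Balaban1987RG1] Thm 2's tuned bare coupling `g₀(ε, g)` UNIQUE for every `γ ≤ γᵤ`
(`TunedUniqueBelow D γᵤ`; hence `UnderHypothesesE → UnderHypotheses` by `toAll_of_tunedUniqueBelow`).  NE4 proper is idle here. [folklore] -/
theorem tunedUniqueBelow_of_u2Inputs (D : FiniteEpsData F G) {c C θ γu b β' : ℝ} {k₀ : ℕ} {Λ : ℕ → ℕ → ℝ}
    (hI : U2Inputs D c C θ γu Λ) (hθ0 : 0 ≤ θ) (hθ1 : θ < 1) (hb : 0 < b) (hlo : EventualLowerH b γu k₀ D.βfun)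
    (hhi : BetaUpperH β' γu D.βfun) (hγβ : γu ^ 2 * β' < 1)
    (hsmall : C * (((k₀ : ℝ) + 1) * γu ^ 3 + 2 * γu / b) < 1 - θ) : TunedUniqueBelow D γu :=
  tunedUniqueBelow_of_eventualLower D hI.2.1 hI.2.2 hθ0 hθ1 hb hlo hhi hγβ hsmall

/-! ## §4 Upstream face: the triple ⇐ rows NE5 ∧ NE9 ∧ the read-out (R), BY NAME -/

/-- [bookkeeping] **NODE U2's TRIPLE ON THE DATA ⇐ NODE U3** (`T4BetaReadOutLipschitz.ne4_of_u3_on` with `β := D.βfun`, BY NAME):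
on abstract carriers `C`, run-A / run-B term families `EA`, `EB b` (b = run B's unpaired finest coupling) whose read-outs `rA`, `rB`
REPRESENT `D.βfun` on the γ-boxes, row NE5 (`T4OutputRate.NE5`, for every `b ∈ ]0,γ]`), row NE9 (`T4OutputRate.NE9`) with fading
history moduli, and the read-out binders (R) on classes `𝒜A ∋ EA g`, `𝒜B ∋ EB b g` give `U2Inputs D (cr·C₅·θ) (cr·C₉·ω) ? γ ?` — precisely:
`ScaleShiftRate (cr·C₅·θ) θ γ D.βfun ∧ HistLipschitz (cr·Λ(k+1,·)) γ D.βfun ∧ FadingMemory (cr·C₉·ω) ω (cr·Λ(k+1,·))`.  At ONE rate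
`ρ ≥ max θ ω` this is `U2Inputs D (cr·C₅·θ) (cr·C₉·ω) ρ γ (fun k i ↦ cr·Λ (k+1) i)` (`T4BetaReadOut.scaleShiftRate_mono`,
`T4FlagMemory.fadingMemory_mono`).  Every input UNPRINTED (rows NE5, NE9: cell GAPS G-t4-U3-1, G-t4-U3-3; (R): dischargeable on analytic slices
by `Probes.ne4_of_u3_recipe`, cr = 8K/α²). [folklore] -/
theorem u2Inputs_of_u3 (D : FiniteEpsData F G) {C : Carriers} {W : Set (ℕ → ℝ)} {EA : Functional C C.BgA}
    {EB : ℝ → Functional C C.BgB} {𝒜A : Set (Slice C C.BgA)} {𝒜B : Set (Slice C C.BgB)} {rA : ReadOut C C.BgA}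
    {rB : ReadOut C C.BgB} {γ κ θ C₅ C₉ ω cr ρ : ℝ} {Λ : ℕ → ℕ → ℝ}
    (hW : ∀ k (v : Fin (k + 1) → ℝ), v ∈ Box γ k → extd v ∈ W)
    (h5 : ∀ b, 0 < b → b ≤ γ → NE5 EA (EB b) W κ θ C₅) (h9 : NE9 EA W κ Λ) (hΛ : T4OutputRate.FadingMemory C₉ ω Λ)
    (hA : RepresentsA EA rA γ D.βfun) (hB : RepresentsB EB rB γ D.βfun)
    (h𝒜A : ∀ g ∈ W, EA g ∈ 𝒜A) (h𝒜B : ∀ b, 0 < b → b ≤ γ → ∀ g ∈ W, EB b g ∈ 𝒜B)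
    (hr : ReadBoundedOn 𝒜A rA κ cr) (hcov : ReadCovariantOn 𝒜A 𝒜B rA rB κ cr) (hcr : 0 ≤ cr) (hC₅ : 0 ≤ C₅)
    (hθ : 0 ≤ θ) (hω : 0 ≤ ω) (hθρ : θ ≤ ρ) (hωρ : ω ≤ ρ) :
    U2Inputs D (cr * C₅ * θ) (cr * C₉ * ω) ρ γ (fun k i => cr * Λ (k + 1) i) :=
  T4BetaReadOutLipschitz.ne4_of_u3_on_oneRate hW h5 h9 hΛ hA hB h𝒜A h𝒜B hr hcov hcr hC₅ hθ hω hθρ hωρ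

/-- [bookkeeping] … and then node U2's output on the data, END TO END from node U3's rows (`u2Inputs_of_u3` + `u2Output_of_u2Inputs`):
`U2Output D g₀ (2·(cr·C₅·θ)/(1−ρ)) ρ` for every sequence tuned within `]0,γ]`, under the AF binders and the window
`cr·C₉·ω·((k₀+1)γ³ + 2γ/b) ≤ (1−ρ)/2` — literally `T4BetaReadOutLipschitz.injectedRate_of_u3_on` joined to the data. [folklore] -/
theorem u2Output_of_u3 (D : FiniteEpsData F G) {C : Carriers} {W : Set (ℕ → ℝ)} {EA : Functional C C.BgA}
    {EB : ℝ → Functional C C.BgB} {𝒜A : Set (Slice C C.BgA)} {𝒜B : Set (Slice C C.BgB)} {rA : ReadOut C C.BgA}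
    {rB : ReadOut C C.BgB} {γ κ θ C₅ C₉ ω cr ρ b β' g : ℝ} {k₀ : ℕ} {Λ : ℕ → ℕ → ℝ} {g₀ : ℕ → ℝ}
    (hW : ∀ k (v : Fin (k + 1) → ℝ), v ∈ Box γ k → extd v ∈ W)
    (h5 : ∀ b, 0 < b → b ≤ γ → NE5 EA (EB b) W κ θ C₅) (h9 : NE9 EA W κ Λ) (hΛ : T4OutputRate.FadingMemory C₉ ω Λ)
    (hA : RepresentsA EA rA γ D.βfun) (hB : RepresentsB EB rB γ D.βfun)
    (h𝒜A : ∀ g ∈ W, EA g ∈ 𝒜A) (h𝒜B : ∀ b, 0 < b → b ≤ γ → ∀ g ∈ W, EB b g ∈ 𝒜B)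
    (hr : ReadBoundedOn 𝒜A rA κ cr) (hcov : ReadCovariantOn 𝒜A 𝒜B rA rB κ cr) (hcr : 0 ≤ cr) (hC₅ : 0 ≤ C₅)
    (hθ : 0 ≤ θ) (hω : 0 ≤ ω) (hθρ : θ ≤ ρ) (hωρ : ω ≤ ρ) (hρ0 : 0 < ρ) (hρ1 : ρ < 1) (hγ : 0 < γ) (hb : 0 < b)
    (hlo : EventualLowerH b γ k₀ D.βfun) (hhi : BetaUpperH β' γ D.βfun) (hγβ : γ ^ 2 * β' < 1) (ht : D.Tuned γ g g₀)
    (hsmall : cr * C₉ * ω * (((k₀ : ℝ) + 1) * γ ^ 3 + 2 * γ / b) ≤ (1 - ρ) / 2) :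
    U2Output D g₀ (2 * (cr * C₅ * θ) / (1 - ρ)) ρ := by
  have hI := u2Inputs_of_u3 D hW h5 h9 hΛ hA hB h𝒜A h𝒜B hr hcov hcr hC₅ hθ hω hθρ hωρ
  have hC₉ : 0 ≤ C₉ := T4BetaReadOut.fadingMemory_const_nonneg hΛ
  exact u2Output_of_u2Inputs D hI hγ hb hρ0 hρ1 (mul_nonneg (mul_nonneg hcr hC₅) hθ)
    (mul_nonneg (mul_nonneg hcr hC₉) hω) hlo hhi hγβ ht hsmall

end Summit.QuantumFields.BalabanUV.T4Continuum.Spine.NE4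

end
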